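import Summits.BirchSwinnertonDyer.BirchSwinnertonDyer.Theorems.PrintX8VSInputHondaSystemLocalTraces
import Summits.BirchSwinnertonDyer.BirchSwinnertonDyer.Theorems.PrintX8VSInputHondaSystemSprungTowerRelations
import Summits.BirchSwinnertonDyer.Rank1Residual.Additive.KobayashiSignedGenerationOfStab
import HarnessLib

/-!
# The generation clauses (primal form) for the `Δ`-descended Honda points at `ℚ_p` (route `PrintX8VS` / `PrintX8`, support item
# `InputHondaSystem` = stmt-BirchSwinnertonDyer-20413, named fact `Sprung2012.thm22_exists_isHondaSystem`; file 14 of the local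
# series)

HONEST FRAMING (desk `pub/bsd-wall/bsd-inputs`, seat `bsd-inputs-honda-p1`, D-0154 (2) INPUTS): THEOREMS ONLY — no definition, no
named fact, no instance, no `sorry`; closes nothing by itself; BSD is not proved by any of this.

## Setting (files `…LocalTraces`, `…SprungTowerRelations`)

`p` odd, `κ` cyclotomic, `ι`, `W/ℚ` with a `ℤ_p`-model `M` of `W ⊗ ℚ̄_p` (`Δ ∈ ℤ_pˣ`, Hasse coefficient in `𝔪`: good supersingular), the
tower `U n ≤ L_n` with local subgroups `Stab(ζ_{n+1})`, `e = toLoc : E_Ω-points ≃ E(ℚ̄_p)`, the transported action `σ ⋆ Q = e⁻¹(σ•e Q)`,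
Sprung's tower points `cΩ m ∈ L(m) ∩ E₁` (`Λ(cΩ m) = ℓ_m`), `QΩ ∈ L(0) ∩ E₁` with `Λ(QΩ) = p`, `N₁ = #Ẽ(𝔽_p)`, the descended points
`c_n = N₁•𝒟_n(e cΩ_{n+1}) + (p−1)•e QΩ`, `c_{−1} = e QΩ`.

* §1 (GEN) for `n ≥ 1`: `((p−1)N₁²)·E(ℚ_{p,n}) ⊆ ℤ[Γ·c_n] + E(ℚ_{p,n−1}) + p·E(ℚ_{p,n})` — Kobayashi's generation step in `E(k_n)`
  (file `…SprungTowerGeneration`) pushed down by `𝒟_n` (`𝒟_n = p−1` on `E(ℚ_{p,n})`, `𝒟_n` commutes with `Γ`, the `Δ`-bijection).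
* §2 (GEN₀): `((p−1)N₁²)·E(ℚ_p) ⊆ ℤ·c_{−1} + p·E(ℚ_p)` — `Λ(E₁(ℚ_p)) ⊆ pℤ_p = ℤ_p·Λ(QΩ)`, `ℤ` dense in `ℤ_p`, `p³ℤ_p ⊆ Λ(p·E₁(ℚ_p))`.

References: [Sprung2012] F. Sprung, J. Number Theory 132 (2012), Thm. 2.2, Cor. 2.10, Lemmas 7.4–7.5; [Kobayashi2003] S. Kobayashi,
Invent. Math. 152 (2003), Prop. 8.7, Prop. 8.11, Prop. 8.12.
-/

set_option autoImplicit false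
-- the Theorems namespace of this sub repeats the summit name by design (D-0017 nested layout)
set_option linter.dupNamespace false

noncomputable section

open scoped Classical
open Finset PowerSeries

namespace Summit.BirchSwinnertonDyer.BirchSwinnertonDyer.Theorems

namespace SprungHonda

open Literature.NumberTheory.EllipticCurves Literature.NumberTheory.GaloisRepresentations
  Literature.NumberTheory.EllipticCurves.ZpExtension Literature.NumberTheory.EllipticCurves.Kobayashi2003
  Summit.BirchSwinnertonDyer.Rank1Residual.Additive Summit.BirchSwinnertonDyer.Rank1Residual.Additive.PadicCyclotomicTower
  Summit.BirchSwinnertonDyer.Rank1Residual.Additive.BallEval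
open Literature.NumberTheory.EllipticCurves.FormalGroupChart (kernel)

variable {p : ℕ} [hp : Fact p.Prime] (κ : ZpExtension ℚ p) (ι : AlgebraicClosure ℚ →ₐ[ℚ] AlgebraicClosure ℚ_[p])
  (W : WeierstrassCurve ℚ) (U : ℕ → Subgroup (Field.absoluteGaloisGroup ℚ)) [hUf : ∀ n, (U n).FiniteIndex]
  [hUN : ∀ n, (U n).Normal]
  {M : WeierstrassCurve ℤ_[p]} [hE : (M.map PadicInt.Coe.ringHom).IsElliptic] [hEt : (M.map PadicInt.toZMod).IsElliptic]
  [hintΩ : (genFibΩ p M).IsIntegral (Valued.v (R := PadicAlgCl p)).integer]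

/-! ## §0 Torsion and the fixed-point dictionary -/

omit hUf hE hEt hintΩ in
/-- No `p`-power torsion in `L(m) = E(ℚ_p(ζ_m))`, `m ≥ 1` (tree `eq_zero_of_prime_pow_smul_eq_zero_localFixedPointsOfEmb_of_stab`, read
through `toLoc`). [cite: Kobayashi2003, Prop. 8.7] -/
theorem torsionFree_layer_of_stab [W.IsElliptic] (hp2 : p ≠ 2) (hΔ : IsUnit M.Δ) (hA : M.hasseCoeff p ∈ IsLocalRing.maximalIdeal ℤ_[p])
    (hWM : M.baseChange (AlgebraicClosure ℚ_[p]) = W.baseChange (AlgebraicClosure ℚ_[p]))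
    (hU : ∀ n, localSubgroupOfEmb (U n) ι = stab p (n + 1)) (m : ℕ) (hm : 1 ≤ m) :
    ∀ Q ∈ subfieldPoints (genFibΩ p M) (layer p m).toSubfield coeffs_mem_layer, ∀ k : ℕ, p ^ k • Q = 0 → Q = 0 := by
  have hV : genFibΩ p M = W.baseChange (AlgebraicClosure ℚ_[p]) := (genFibΩ_eq_baseChange M).trans hWM
  intro Q hQ k hk
  obtain ⟨m₀, rfl⟩ := Nat.exists_eq_add_of_le' hm
  have hQ' : (toLoc hV Q : localPoints W ℚ_[p]) ∈ localFixedPointsOfEmb ι W (U m₀) := by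
    rw [mem_localFixedPointsOfEmb_iff_mem_subfieldPoints ι hV hU]; simpa using hQ
  have := eq_zero_of_prime_pow_smul_eq_zero_localFixedPointsOfEmb_of_stab ι W U hp2 M hΔ hA hWM hU m₀ k (toLoc hV Q) hQ'
    (by rw [← map_nsmul, hk, map_zero])
  exact (toLoc hV).injective (by rw [this, map_zero])

/-! ## §1 (GEN) for `n ≥ 1` -/

/-- **(GEN) for `n ≥ 1`.** For `P ∈ E(ℚ_{p,n})` there are `B ∈ ℤ[Γ·c_n]`, `P' ∈ E(ℚ_{p,n−1})`, `R ∈ E(ℚ_{p,n})` with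
`((p−1)N₁²)•P = B + P' + p•R`, where `c_n = N₁•𝒟_n(e cΩ_{n+1}) + (p−1)•e QΩ`: Kobayashi's step
`N₁•P ∈ ℤ[Γ·e cΩ_{n+1}] + E(k_{n−1}) + p·E(k_n)` (file `…SprungTowerGeneration`, `N₁•P ∈ E₁`) pushed down by `𝒟_n`.
[cite: Kobayashi2003, Prop. 8.12] [cite: Sprung2012, Thm. 2.2 (p. 1487) and Lemmas 7.4–7.5] -/
theorem descent_generation [W.IsElliptic] (hp2 : p ≠ 2) (hκ : κ.IsCyclotomic) (hUL : ∀ n, U n ≤ κ.layerSubgroup n)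
    (hU : ∀ n, localSubgroupOfEmb (U n) ι = stab p (n + 1)) (hΔ : IsUnit M.Δ) (hA : M.hasseCoeff p ∈ IsLocalRing.maximalIdeal ℤ_[p])
    (hWM : M.baseChange (AlgebraicClosure ℚ_[p]) = W.baseChange (AlgebraicClosure ℚ_[p]))
    (hV : genFibΩ p M = W.baseChange (AlgebraicClosure ℚ_[p]))
    {x : ℕ → ℚ_[p]} (hx0 : x 0 = 1) (hxb : ∀ k, ‖x k‖ ≤ Real.sqrt p ^ k)
    {i j : ℤ_[p]⟦X⟧} (hi0 : constantCoeff i = 0) (hj0 : constantCoeff j = 0) (hij : i.subst j = PowerSeries.X)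
    (hlog : (M.map (PadicInt.Coe.ringHom (p := p))).formalLog.subst (i.map PadicInt.Coe.ringHom) =
      PowerSeries.mk fun d ↦ ∑' k : ℕ, x k * (((p ^ k).choose d : ℚ_[p]) - if d = 0 then 1 else 0))
    {cΩ : ℕ → (genFibΩ p M).toAffine.Point}
    (hcL : ∀ m, cΩ m ∈ subfieldPoints (genFibΩ p M) (layer p m).toSubfield coeffs_mem_layer)
    (hck : ∀ m, cΩ m ∈ kernel (Valued.v (R := PadicAlgCl p)) (genFibΩ p M))
    (hcΛ : ∀ m, ptLogΩ p M (cΩ m) = ∑ k ∈ range m, algebraMap ℚ_[p] (PadicAlgCl p) (x k) * (zeta p (m - k) - 1))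
    {QΩ : (genFibΩ p M).toAffine.Point} (hQL : QΩ ∈ subfieldPoints (genFibΩ p M) (layer p 0).toSubfield coeffs_mem_layer)
    {N₁ : ℕ} (hN₁ : N₁ = Nat.card (M.map PadicInt.toZMod).toAffine.Point)
    (c : ℕ → localPoints W ℚ_[p])
    (hc : ∀ n, c n = (N₁ : ℤ) • localPairTraceOfEmb ι W (κ.layerSubgroup n) (U n) (toLoc hV (cΩ (n + 1))) +
      ((p : ℤ) - 1) • toLoc hV QΩ)
    {n : ℕ} (hn : 1 ≤ n) {P : localPoints W ℚ_[p]} (hP : P ∈ localLayerPointsOfEmb κ ι W n) :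
    ∃ B ∈ AddSubgroup.closure (Set.range fun σ : Field.absoluteGaloisGroup ℚ_[p] ↦ σ • c n),
      ∃ P' ∈ localLayerPointsOfEmb κ ι W (n - 1), ∃ R ∈ localLayerPointsOfEmb κ ι W n,
        ((p - 1) * N₁ * N₁) • P = B + P' + p • R := by
  obtain ⟨k, rfl⟩ := Nat.exists_eq_add_of_le' hn
  rw [Nat.add_sub_cancel]
  -- notation and the transported action
  set e := toLoc hV with he
  set act : Field.absoluteGaloisGroup ℚ_[p] → (genFibΩ p M).toAffine.Point → (genFibΩ p M).toAffine.Point :=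
    fun σ Q ↦ e.symm (σ • e Q) with hact_def
  have hact0 : ∀ σ, act σ 0 = 0 := fun σ ↦ act_zero hV σ
  have hact : ∀ σ (x y : PadicAlgCl p) (h : (genFibΩ p M).toAffine.Nonsingular x y),
      ∃ h', act σ (WeierstrassCurve.Affine.Point.some x y h) = WeierstrassCurve.Affine.Point.some (σ • x) (σ • y) h' :=
    fun σ x y h ↦ act_some hV σ x y h
  have he_act : ∀ σ Q, e (act σ Q) = σ • e Q := fun σ Q ↦ by simp only [hact_def, AddEquiv.apply_symm_apply]
  have hFix : ∀ k (P : localPoints W ℚ_[p]), P ∈ localFixedPointsOfEmb ι W (U k) ↔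
      e.symm P ∈ subfieldPoints (genFibΩ p M) (layer p (k + 1)).toSubfield coeffs_mem_layer :=
    fun k P ↦ mem_localFixedPointsOfEmb_iff_mem_subfieldPoints ι hV hU k P
  have hmono := localLayerPointsOfEmb_mono κ ι W
  have htorsΩ := torsionFree_layer_of_stab ι W U hp2 hΔ hA hWM hU
  -- `e QΩ ∈ E(ℚ_p)`
  have hQ0 : e QΩ ∈ localLayerPointsOfEmb κ ι W 0 := by
    rw [mem_localLayerPointsOfEmb_zero_iff]
    exact (mem_localFixedPointsOfEmb_top_iff ι W _).mp
      ((mem_localFixedPointsOfEmb_top_iff_mem_subfieldPoints ι hV _).mpr (by simpa [he] using hQL))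
  -- the `Δ`-trace `𝒟 = 𝒟_{k+1}`
  set 𝒟 := localPairTraceOfEmb ι W (κ.layerSubgroup (k + 1)) (U (k + 1)) with h𝒟
  have hPU : P ∈ localFixedPointsOfEmb ι W (U (k + 1)) := localLayerPointsOfEmb_le_localFixedPointsOfEmb κ ι W U hUL (k + 1) hP
  -- Kobayashi's step in `E(k_{k+1}) = L(k+2)` for `N₁•P ∈ E₁`
  set QP := e.symm P with hQP
  have hQPL : QP ∈ subfieldPoints (genFibΩ p M) (layer p (k + 2)).toSubfield coeffs_mem_layer := (hFix (k + 1) P).mp hPU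
  have hN₁k : N₁ • QP ∈ kernel (Valued.v (R := PadicAlgCl p)) (genFibΩ p M) := by
    rw [hN₁]; exact card_smul_mem_kernel_of_mem_subfieldPoints M hQPL
  obtain ⟨BΩ, hBΩ, RΩ, hRΩL, -, hFΩ⟩ := exists_sub_closure_sub_smul_mem_sprung hp2 hxb hi0 hj0 hij hlog act hact0 hact
    (m := k + 2) (by omega) (htorsΩ (k + 2) (by omega)) (hcL (k + 2)) (hck (k + 2)) (hcΛ (k + 2)) hx0
    ((subfieldPoints _ _ _).nsmul_mem hQPL N₁) hN₁k
  rw [show k + 2 - 1 = k + 1 from rfl] at hFΩ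
  -- transport back to `E(ℚ̄_p)`
  set B₁ : localPoints W ℚ_[p] := e BΩ with hB₁def
  set R₁ : localPoints W ℚ_[p] := e RΩ with hR₁def
  have hB₁cl : B₁ ∈ AddSubgroup.closure (Set.range fun σ : Field.absoluteGaloisGroup ℚ_[p] ↦ σ • e (cΩ (k + 2))) := by
    have himg : (AddSubgroup.closure (Set.range fun σ : Field.absoluteGaloisGroup ℚ_[p] ↦ act σ (cΩ (k + 2)))).map
        e.toAddMonoidHom ≤ AddSubgroup.closure (Set.range fun σ : Field.absoluteGaloisGroup ℚ_[p] ↦ σ • e (cΩ (k + 2))) := by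
      rw [AddMonoidHom.map_closure]
      refine AddSubgroup.closure_mono ?_
      rintro _ ⟨_, ⟨σ, rfl⟩, rfl⟩
      exact ⟨σ, (he_act σ _).symm⟩
    exact himg ⟨BΩ, hBΩ, rfl⟩
  have hR₁ : R₁ ∈ localFixedPointsOfEmb ι W (U (k + 1)) := by
    rw [hFix, hR₁def, AddEquiv.symm_apply_apply]; exact hRΩL
  have hF₁ : N₁ • P - B₁ - p • R₁ ∈ localFixedPointsOfEmb ι W (U k) := by
    rw [hFix, map_sub, map_sub, map_nsmul, map_nsmul, hB₁def, hR₁def, AddEquiv.symm_apply_apply, AddEquiv.symm_apply_apply]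
    exact hFΩ
  have hc₁ : e (cΩ (k + 2)) ∈ localFixedPointsOfEmb ι W (U (k + 1)) := by
    rw [hFix, AddEquiv.symm_apply_apply]; exact hcL (k + 2)
  -- push down by `𝒟`
  have hDP : 𝒟 P = (p - 1) • P := localPairTraceOfEmb_of_mem_layer κ ι W U hp2 hκ hU hP
  have hDB : 𝒟 B₁ ∈ AddSubgroup.closure (Set.range fun σ : Field.absoluteGaloisGroup ℚ_[p] ↦ σ • 𝒟 (e (cΩ (k + 2)))) := by
    rw [← map_localPairTraceOfEmb_closure_orbit κ ι W U (k + 1) hc₁]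
    exact ⟨B₁, hB₁cl, rfl⟩
  have hDF : 𝒟 (N₁ • P - B₁ - p • R₁) ∈ localLayerPointsOfEmb κ ι W k := by
    rw [h𝒟, localPairTraceOfEmb_succ_eq κ ι W U hp2 hκ hU hF₁]
    exact localPairTraceOfEmb_mem_layer κ ι W U k hF₁
  have hDR : 𝒟 R₁ ∈ localLayerPointsOfEmb κ ι W (k + 1) := localPairTraceOfEmb_mem_layer κ ι W U (k + 1) hR₁
  -- `N₁•𝒟B₁ ∈ ℤ[Γ·c_{k+1}] + E(ℚ_{p,k})`
  set S := AddSubgroup.closure (Set.range fun σ : Field.absoluteGaloisGroup ℚ_[p] ↦ σ • c (k + 1)) ⊔ localLayerPointsOfEmb κ ι W k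
    with hS
  have hNDB : N₁ • 𝒟 B₁ ∈ S := by
    refine AddSubgroup.closure_induction (p := fun X _ ↦ N₁ • X ∈ S) ?_ ?_ ?_ ?_ hDB
    · rintro _ ⟨σ, rfl⟩
      have hfixQ : σ • e QΩ = e QΩ := (mem_localLayerPointsOfEmb_zero_iff κ ι W _).mp hQ0 σ
      have heq : N₁ • σ • 𝒟 (e (cΩ (k + 2))) = σ • c (k + 1) - ((p : ℤ) - 1) • e QΩ := by
        rw [hc (k + 1), smul_add, smul_comm σ ((p : ℤ) - 1) (e QΩ), hfixQ, add_sub_cancel_right, smul_comm σ (N₁ : ℤ),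
          natCast_zsmul]
      rw [heq]
      exact sub_mem (AddSubgroup.mem_sup_left (AddSubgroup.subset_closure ⟨σ, rfl⟩))
        (AddSubgroup.mem_sup_right (AddSubgroup.zsmul_mem _ (hmono (Nat.zero_le k) hQ0) _))
    · rw [smul_zero]; exact S.zero_mem
    · intro X Y _ _ hX hY; rw [smul_add]; exact S.add_mem hX hY
    · intro X _ hX; rw [smul_neg]; exact S.neg_mem hX
  obtain ⟨B, hB, Y, hY, hBY⟩ := AddSubgroup.mem_sup.mp hNDB
  -- assemble
  have hNP : N₁ • P = (N₁ • P - B₁ - p • R₁) + B₁ + p • R₁ := by abel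
  refine ⟨B, hB, Y + N₁ • 𝒟 (N₁ • P - B₁ - p • R₁), add_mem hY (AddSubgroup.nsmul_mem _ hDF _), N₁ • 𝒟 R₁,
    AddSubgroup.nsmul_mem _ hDR _, ?_⟩
  calc ((p - 1) * N₁ * N₁) • P = N₁ • N₁ • (p - 1) • P := by rw [show (p - 1) * N₁ * N₁ = N₁ * (N₁ * (p - 1)) by ring,
        mul_smul, mul_smul]
    _ = N₁ • 𝒟 (N₁ • P) := by rw [← hDP, map_nsmul]
    _ = N₁ • 𝒟 ((N₁ • P - B₁ - p • R₁) + B₁ + p • R₁) := by rw [← hNP]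
    _ = N₁ • 𝒟 (N₁ • P - B₁ - p • R₁) + N₁ • 𝒟 B₁ + p • N₁ • 𝒟 R₁ := by
        rw [map_add, map_add, map_nsmul, smul_add, smul_add, smul_comm N₁ p]
    _ = B + (Y + N₁ • 𝒟 (N₁ • P - B₁ - p • R₁)) + p • N₁ • 𝒟 R₁ := by rw [← hBY]; abel


/-! ## §2 (GEN₀) -/

omit hUf in
/-- **(GEN₀).** For `P ∈ E(ℚ_p)` there are `u ∈ ℤ` and `R ∈ E(ℚ_p)` with `((p−1)N₁²)•P = u•(e QΩ) + p•R`: `N₁•P ∈ E₁(ℚ_p)` has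
`Λ(N₁•P) = pμ` with `μ ∈ ℤ_p` (`Λ(E₁(ℚ_p)) ⊆ pℤ_p`), `μ ≡ u (mod p²)` for an integer `u`, and `p³ℤ_p ⊆ Λ(p·E₁(ℚ_p))`
(tree `exists_mem_kernel_ptLogΩ_eq`), `Λ(QΩ) = p`, `Λ` injective on the torsion-free `L(1) ∩ E₁`.
[cite: Sprung2012, Thm. 2.2 (p. 1487) ("F_ss(𝔪_{−1}) is generated by c_{−1}")] [cite: Kobayashi2003, Prop. 8.7] -/
theorem descent_generation_zero [W.IsElliptic] (hp2 : p ≠ 2) (hU : ∀ n, localSubgroupOfEmb (U n) ι = stab p (n + 1))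
    (hΔ : IsUnit M.Δ) (hA : M.hasseCoeff p ∈ IsLocalRing.maximalIdeal ℤ_[p])
    (hWM : M.baseChange (AlgebraicClosure ℚ_[p]) = W.baseChange (AlgebraicClosure ℚ_[p]))
    (hV : genFibΩ p M = W.baseChange (AlgebraicClosure ℚ_[p]))
    {QΩ : (genFibΩ p M).toAffine.Point} (hQL : QΩ ∈ subfieldPoints (genFibΩ p M) (layer p 0).toSubfield coeffs_mem_layer)
    (hQk : QΩ ∈ kernel (Valued.v (R := PadicAlgCl p)) (genFibΩ p M)) (hQΛ : ptLogΩ p M QΩ = (p : PadicAlgCl p))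
    {N₁ : ℕ} (hN₁ : N₁ = Nat.card (M.map PadicInt.toZMod).toAffine.Point)
    {P : localPoints W ℚ_[p]} (hP : P ∈ localLayerPointsOfEmb κ ι W 0) :
    ∃ u : ℤ, ∃ R ∈ localLayerPointsOfEmb κ ι W 0, ((p - 1) * N₁ * N₁) • P = u • toLoc hV QΩ + p • R := by
  haveI := isIntegral_curveK p (LayerField p 1) M
  haveI := isIntegral_curveK p (LayerField p 0) M
  set e := toLoc hV with he
  have htorsΩ := torsionFree_layer_of_stab ι W U hp2 hΔ hA hWM hU
  have hLay0 : ∀ X : localPoints W ℚ_[p], X ∈ localLayerPointsOfEmb κ ι W 0 ↔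
      e.symm X ∈ subfieldPoints (genFibΩ p M) (layer p 0).toSubfield coeffs_mem_layer := fun X ↦ by
    rw [mem_localLayerPointsOfEmb_zero_iff, ← mem_localFixedPointsOfEmb_top_iff ι W,
      mem_localFixedPointsOfEmb_top_iff_mem_subfieldPoints ι hV]
  have hp0 : (0 : ℝ) < p := by exact_mod_cast hp.out.pos
  have hp3 : (3 : ℝ) ≤ p := by
    have := hp.out.two_le; exact_mod_cast (by omega : 3 ≤ p)
  -- `X = N₁•P` on the `E_Ω`-side: in `L(0) ∩ E₁`
  set QP := e.symm P with hQP
  have hQPL : QP ∈ subfieldPoints (genFibΩ p M) (layer p 0).toSubfield coeffs_mem_layer := (hLay0 P).mp hP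
  have hXL : N₁ • QP ∈ subfieldPoints (genFibΩ p M) (layer p 0).toSubfield coeffs_mem_layer := (subfieldPoints _ _ _).nsmul_mem hQPL _
  have hXk : N₁ • QP ∈ kernel (Valued.v (R := PadicAlgCl p)) (genFibΩ p M) := by
    rw [hN₁]; exact card_smul_mem_kernel_of_mem_subfieldPoints M hQPL
  -- `Λ(X) ∈ ℚ_p` with `‖Λ(X)‖ ≤ p⁻¹`
  have hz1 : ‖(N₁ • QP).zCoord‖ < 1 := norm_zCoord_lt_one_of_mem_kernel hXk
  obtain ⟨q, hq⟩ : ∃ q : ℚ_[p], algebraMap ℚ_[p] (PadicAlgCl p) q = (N₁ • QP).zCoord := by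
    have h := zCoord_mem_layer hXL
    rw [PadicCyclotomicTower.layer_zero, IntermediateField.mem_bot] at h
    exact h
  have hqn : ‖q‖ ≤ (p : ℝ)⁻¹ := by
    have h1 : ‖q‖ < 1 := by rw [← norm_algebraMap' (PadicAlgCl p) q, hq]; exact hz1
    have := (Padic.norm_lt_pow_iff_norm_le_pow_sub_one q 0).mp (by simpa using h1)
    simpa using this
  have hzhalf : ‖(N₁ • QP).zCoord‖ < 1 / 2 := by
    rw [← hq, norm_algebraMap']
    refine lt_of_le_of_lt hqn ?_
    rw [inv_lt_comm₀ hp0 (by norm_num)]; linarith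
  have hΛmem : ptLogΩ p M (N₁ • QP) ∈ layer p 0 := ptLogΩ_mem_layer hXL hXk
  obtain ⟨ℓ, hℓ⟩ : ∃ ℓ : ℚ_[p], algebraMap ℚ_[p] (PadicAlgCl p) ℓ = ptLogΩ p M (N₁ • QP) := by
    rw [PadicCyclotomicTower.layer_zero, IntermediateField.mem_bot] at hΛmem; exact hΛmem
  have hℓn : ‖ℓ‖ ≤ (p : ℝ)⁻¹ := by
    rw [← norm_algebraMap' (PadicAlgCl p) ℓ, hℓ, norm_ptLogΩ_eq_of_lt_half hXL hXk hzhalf, ← hq, norm_algebraMap']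
    exact hqn
  -- `ℓ = p μ`, `μ ∈ ℤ_p`, `μ = u + p² ν`
  have hpq : (p : ℚ_[p]) ≠ 0 := by exact_mod_cast hp.out.ne_zero
  have hμn : ‖ℓ / p‖ ≤ 1 := by
    rw [norm_div, Padic.norm_p, div_le_iff₀ (inv_pos.mpr hp0), one_mul]; exact hℓn
  set μ : ℤ_[p] := ⟨ℓ / p, hμn⟩ with hμ
  obtain ⟨ν, hν⟩ : ∃ ν : ℤ_[p], μ - (μ.appr 2 : ℕ) = (p : ℤ_[p]) ^ 2 * ν :=
    Ideal.mem_span_singleton'.mp (PadicInt.appr_spec 2 μ) |>.imp fun ν h ↦ by rw [← h, mul_comm]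
  have hℓeq : ℓ = (p : ℚ_[p]) * ((μ.appr 2 : ℕ) : ℚ_[p]) + (p : ℚ_[p]) ^ 3 * (ν : ℚ_[p]) := by
    have hμq : ((μ : ℤ_[p]) : ℚ_[p]) = ℓ / p := rfl
    have := congrArg (fun t : ℤ_[p] ↦ (t : ℚ_[p])) hν
    push_cast at this
    rw [hμq] at this
    field_simp at this
    linear_combination this
  -- a point `RΩ ∈ L(0) ∩ E₁` with `Λ(RΩ) = p² ν`
  set z : PadicAlgCl p := algebraMap ℚ_[p] (PadicAlgCl p) ((p : ℚ_[p]) ^ 2 * (ν : ℚ_[p])) with hzdef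
  have hzL : z ∈ layer p 0 := (layer p 0).algebraMap_mem _
  have hz4 : ‖z‖ ≤ 1 / 4 := by
    rw [hzdef, norm_algebraMap', norm_mul, norm_pow, Padic.norm_p]
    calc (p : ℝ)⁻¹ ^ 2 * ‖(ν : ℚ_[p])‖ ≤ (3 : ℝ)⁻¹ ^ 2 * 1 := by
          gcongr
          · exact PadicInt.norm_le_one ν
      _ ≤ 1 / 4 := by norm_num
  obtain ⟨RΩ, hRL, hRk, hRΛ⟩ := exists_mem_kernel_ptLogΩ_eq (M := M) hzL hz4
  -- `X − u•QΩ = p•RΩ` by comparing logarithms in the torsion-free `L(1) ∩ E₁`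
  set u : ℤ := ((μ.appr 2 : ℕ) : ℤ) with hu
  have hL1 := fun {Q : (genFibΩ p M).toAffine.Point}
      (h : Q ∈ subfieldPoints (genFibΩ p M) (layer p 0).toSubfield coeffs_mem_layer) ↦ subfieldPoints_layer_mono (Nat.zero_le 1) h
  have heq : N₁ • QP - u • QΩ = p • RΩ := by
    refine eq_of_ptLogΩ_eq (m := 1) (htorsΩ 1 le_rfl) (hL1 ((subfieldPoints _ _ _).sub_mem hXL ((subfieldPoints _ _ _).zsmul_mem hQL u)))
      (hL1 ((subfieldPoints _ _ _).nsmul_mem hRL p))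
      ((kernel _ _).sub_mem hXk ((kernel _ _).zsmul_mem hQk u)) ((kernel _ _).nsmul_mem hRk p) ?_
    rw [ptLogΩ_sub (m := 0) hXL ((subfieldPoints _ _ _).zsmul_mem hQL u) hXk ((kernel _ _).zsmul_mem hQk u),
      ptLogΩ_zsmul (m := 0) hQL hQk, ptLogΩ_nsmul (m := 0) hRL hRk, hQΛ, hRΛ, ← hℓ, hℓeq, hzdef, hu]
    simp only [map_add, map_mul, map_pow, map_natCast, Int.cast_natCast]
    rw [show algebraMap ℚ_[p] (PadicAlgCl p) (ν : ℚ_[p]) = algebraMap ℚ_[p] (PadicAlgCl p) (ν : ℚ_[p]) from rfl]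
    ring
  -- transport and rescale
  have hR0 : e RΩ ∈ localLayerPointsOfEmb κ ι W 0 := by rw [hLay0, AddEquiv.symm_apply_apply]; exact hRL
  have hNP : N₁ • P = u • e QΩ + p • e RΩ := by
    have := congrArg e heq
    rw [map_sub, map_nsmul, map_zsmul, hQP, AddEquiv.apply_symm_apply, map_nsmul] at this
    rw [← this]; abel
  refine ⟨(((p - 1) * N₁ : ℕ) : ℤ) * u, ((p - 1) * N₁) • e RΩ, AddSubgroup.nsmul_mem _ hR0 _, ?_⟩
  rw [mul_smul, hNP, smul_add, mul_zsmul, smul_comm ((p - 1) * N₁) p]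
  simp only [natCast_zsmul]

end SprungHonda

end Summit.BirchSwinnertonDyer.BirchSwinnertonDyer.Theorems

end
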